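import Summits.BirchSwinnertonDyer.BirchSwinnertonDyer.Theorems.ManinLocalTwoThreeLineV17ByName
import Literature.NumberTheory.EllipticCurves.KatoAdditiveTwistedValueNeronIntegralityThreeKPForms
import HarnessLib

/-!
# The C3 line `kato_shift_three` v18 BY NAME, as ONE tree theorem: C3 ⟸ F₃♮ ∧ E-an-57 ∧ LAW₃♮ ∧ T3III ∧ T3W ∧ RES₃♭

Summit `BirchSwinnertonDyer`, route `ManinLocalTwoThree` (cell bsd-f2-manin), deciding crux C3 `ManinPrimeToThreeAtNine`
(stmt-BirchSwinnertonDyer-22968), line `kato_shift_three`, skeleton **v18** (lead p1 gen 9, REGISTERED on the crux item 2026-08-28T20:53Z;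
HOME/p1/Line-kato-shift-three-v18.lean; the crux write `Lines/kato_shift_three.lean := v18` is owed by the planner-of-record).  v18 = v17
with the Kato stub RE-POINTED to the Kosters–Pannekoek form F₃♮ `kato_neron_isIntegral_twistedSymbolSum_of_additive_three_kp` (typer
p663409; es MEMO-es §36, «ONE Kato stub suffices»), from which v17's polar fact F-es-18 follows by the Literature's PROVED edge
`polar_of_kp` (p664127).  This file records the v18 composition as a tree theorem next to `…LineV17ByName.lean`
(`maninPrimeToThreeAtNine_of_katoFact_of_cuspidalKummerCube_of_nonBlindLaw_of_positionLaws_of_coprimeIsolated`, lead p1 gen 7), so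
that the by-name reduction of record is importable while the crux write is pending (LEAD custody, p1 gen 11).

SIX hypotheses, ALL BY NAME: F₃♮ (Kato, Literature, statement-only), E-an-57 `CuspidalKummerCubeRepresentativeAtNine`, LAW₃♮
`CuspidalKummerCubeExponentLawNonBlind`, T3III `OptimalRationalThreeTorsionIsTypeIII`, T3W `OptimalRationalThreeTorsionWildPosition`, RES₃♭
`NoRationalThreeTorsionCoprimeIsolatedResidual`.  HONEST FRAMING: a CONDITIONAL reduction; every hypothesis is an OPEN cell law or an
unformalised printed theorem (F₃♮); C3, Manin's conjecture and BSD are NOT proved.  No definitions, no named facts, no sorry.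
-/

set_option linter.dupNamespace false
set_option autoImplicit false

noncomputable section

open scoped Classical

open WeierstrassCurve Literature.NumberTheory.EllipticCurves Literature.NumberTheory.EllipticCurves.ModularForms
  Summit.BirchSwinnertonDyer.Rank1Residual.ManinAdditive
  Summit.BirchSwinnertonDyer.Rank1Residual.ManinAdditive.CuspidalKummer
  Summit.BirchSwinnertonDyer.Rank1Residual.ManinAdditive.CuspidalKummerThree
  Summit.BirchSwinnertonDyer.Rank1Residual.ManinAdditive.ThreeIsogenyKernel

namespace Summit.BirchSwinnertonDyer.BirchSwinnertonDyer.Theorems.ManinLocalTwoThree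

/-- **The C3 line `kato_shift_three` v18 BY NAME: C3 `ManinPrimeToThreeAtNine` ⟸ F₃♮ ∧ E-an-57 ∧ LAW₃♮ ∧ T3III ∧ T3W ∧ RES₃♭.**
The Kato input is the Kosters–Pannekoek form F₃♮; v17's polar fact is `polar_of_kp h₁`; the rest is the v17 composition.  CONDITIONAL
reduction; nothing about BSD or Manin's conjecture is proved. [cite: Kato2004Asterisque, Thm. 12.5 (shape of the input F₃♮ only)] -/
theorem maninPrimeToThreeAtNine_of_katoFactKP_of_cuspidalKummerCube_of_nonBlindLaw_of_positionLaws_of_coprimeIsolated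
    (h₁ : kato_neron_isIntegral_twistedSymbolSum_of_additive_three_kp) (h₂ : CuspidalKummerCubeRepresentativeAtNine)
    (h₄ : CuspidalKummerCubeExponentLawNonBlind) (h112 : OptimalRationalThreeTorsionIsTypeIII)
    (hW : OptimalRationalThreeTorsionWildPosition) (h₅ : NoRationalThreeTorsionCoprimeIsolatedResidual) :
    Summit.BirchSwinnertonDyer.BirchSwinnertonDyer.Theses.ManinLocalTwoThree.ManinPrimeToThreeAtNine :=
  maninPrimeToThreeAtNine_of_katoFact_of_cuspidalKummerCube_of_nonBlindLaw_of_positionLaws_of_coprimeIsolated (polar_of_kp h₁)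
    h₂ h₄ h112 hW h₅

end Summit.BirchSwinnertonDyer.BirchSwinnertonDyer.Theorems.ManinLocalTwoThree

end
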